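import Summits.QuantumFields.BalabanUV.Beta.GAN24.ClosedFormRateOfParts
import Summits.QuantumFields.BalabanUV.Beta.GAN24.ReadingWeightRatesSum

/-!
# `BalabanUV.Beta.GAN24.FibreRateTBlock` — binder row G-an2-4 / (CONV-C), road P1-fibre, self-row **P1-Y11t\*** (a sub-part of p1 row L11
# `FibreRate`, offered to its owner in CLAIMS l.3009), part 1: the CAPACITANCE-FREE («T-block») share of the field–field leg of the
# closed-form fibre function and its EXACT PHASE/MODULUS FACTORISATION at real momentum

NOT IN PRINT; OUR PROOF ATTEMPT.  HONEST FRAMING (cell contract, verbatim): «discharging `BetaPertH` makes Bałaban's UV stability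
UNCONDITIONAL — a real constructive-QFT result; it is NOT the continuum limit and NOT the Clay problem.»  HONEST DEPENDENCY (verbatim):
«continuum YM on T⁴ ⇐ BetaPertH ∧ nine spine estimates (0/9 proved); BetaPertH ⇐ (D1) ∧ (D4) ∧ CAP+tail; G-an2-4 gates asym, D1 and
NE2/3/4.»  [folklore] exact finite algebra over the DEFINITIONS of typer row T00 `GAN24/AliasObjects` (`readW srcW dAl dbAl LAl sMAl SMAl
sbMAl SbMAl fhatF Ahat gAl phiSol cSol chiAl sbAl gs`), p1's `FibreBlockSolve.Asol` (its additivity in `(g, cc)` re-derived inline by `ring`), part 1 of row Y11d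
`GAN24/AliasReindex` (`kSym`, `srep`, the `2π`-periodicity dictionary) and leaf-17's `ReadingWeightRatesSum` currency — all BY NAME; three
harmless data `def`s (`tTerm`, `qlab`, `rf`), NO estimate, NO cited fact, NO `def … : Prop`, NO wall binder, NO unit re-typed (c1–c3).
NOT summit progress; nothing of (CONV-C)'s K-slot is discharged here.

## What is proved
* §1 THE T-SUMMAND `tTerm N M p m κ l x′ y′ := readW(m,κ,x′)·srcW(m,l,y′)·(δ_{κl} − ∂_{mκ}∂♭_{ml}/L_m)/(2L_m)` and THE SPLIT of the ff summand of
  `kFibClosedW`: `readW·Â_κ(m)[force (l,y′)] = tTerm + readW·Asol(∂_m,∂♭_m, FEED_m, L_m, χ̂_m c)_κ` with `FEED_m = χ̂_m·s♭(m) ⊙ φ`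
  (`Asol_fhatF_zero`, `readW_mul_Asol_fhatF_zero`, `Asol_add_apply`, `Ahat_fhatF_split`, `ff_summand_split`) — by linearity of `Asol` in `(g, cc)`; the feed share
  (through the capacitance solve `φ, c`) stays with the L11 owner's `CapacitanceRate`/assembly.
* §2 AT REAL MOMENTUM `p = ofRealVec pr`, with the symmetric label `qlab pr m i = pr_i + 2π·srep m i` (`kSym N p m = ofRealVec (qlab/N)`,
  `kSym_ofRealVec`) and block relation `N = M·Lc`: the level-free identities `s_{M,κ}(m)·∂_{mκ} = e^{i q_κ/Lc} − 1`, `s♭_{M,l}(m)·∂♭_{ml} = e^{−i q_l/Lc} − 1`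
  (`sMAl_mul_dAl`, `sbMAl_mul_dbAl` — B1's «first-order terms are pure phases that cancel», in kernel form: NO `M`-dependent half-cell phase
  survives), the real moduli `S_M S♭_M = M^{2D}·Π_i rf²`, `s_{M,κ}s♭_{M,κ} = M²·rf_κ²` with `rf N M q := ‖gs(q/N, M)‖/M` (leaf-17's reading factor),
  the reading phase `e^{i q·(x′−y′)/Lc}` (`readPhase_mul_srcPhase`), `L_m = ℓ/N²` with `ℓ = King1986.latticeSymbol N⁻¹ 0 (qlab)` (`LAl_ofRealVec_eq`),
  and **`tTerm_factor`**: `N^D · tTerm = e^{i q·(x′−y′)/Lc} · N² · Π_i rf(q_i)² · ( [κ=l]·rf(q_κ)²/(2ℓ) − Lc²·(e^{iq_κ/Lc} − 1)(e^{−iq_l/Lc} − 1)/(2ℓ²) )`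
  — the ENTIRE level-dependence of the normalised T-summand `N^{D−2}·tTerm` sits in the REAL numbers `rf(q_i)` and `ℓ(q)` (two-level rates: part 2).
Consumers: part 2 `GAN24/FibreRateTBlockRate` (per-label rates/bounds), part 3 (sums), p1 row L11 `FibreRate` (leaf-20-g7).
-/

noncomputable section

open Complex Finset
open scoped BigOperators Real ComplexConjugate
open Literature.Probability.LatticeModels (TorusSite)
open Literature.MathematicalPhysics.QuantumFieldTheory
open Literature.MathematicalPhysics.QuantumFieldTheory.Balaban1983to89
open Literature.MathematicalPhysics.QuantumFieldTheory.Balaban1983to89.Beta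
open Literature.MathematicalPhysics.QuantumFieldTheory.King1986 (latticeSymbol)
open B4Strip (ofRealVec)
open Summit.QuantumFields.BalabanUV.Beta.GAN24.FibreSymbols (dhat dflat lapSym)
open Summit.QuantumFields.BalabanUV.Beta.GAN24.FibreBlockSolve (dot Asol)
open Summit.QuantumFields.BalabanUV.Beta.GAN24.AliasObjects
  (kAl gs sAl SAl sbAl SbAl chiAl dAl dbAl LAl sMAl SMAl sbMAl SbMAl readW srcW fhatF Ahat gAl phiSol cSol)
open Summit.QuantumFields.BalabanUV.Beta.GAN24.AliasReindex
  (srep kSym kSym_apply sMAl_eq_kSym sbMAl_eq_kSym SMAl_eq_kSym SbMAl_eq_kSym dAl_eq_kSym dbAl_eq_kSym LAl_eq_kSym readPhase_eq_kSym srcPhase_eq_kSym)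

namespace Summit.QuantumFields.BalabanUV.Beta.GAN24.FibreRateTBlock

variable {D : ℕ}

/-! ## §1 The T-summand and the split of the field–field summand -/

section Split

variable (N M : ℕ) [NeZero N] (p : Fin D → ℂ)

/-- [folklore] THE T-SUMMAND of the field–field leg: `readW(m,κ,x′)·srcW(m,l,y′)·(δ_{κl} − ∂_{mκ}∂♭_{ml}/L_m)/(2L_m)` — the response of block `m`
to its OWN force source through the transverse massless propagator `Π⊥_m/(2L_m)`, read by the field leg; no capacitance feedback. -/
def tTerm (m : TorusSite D N) (κ l : Fin D) (x' y' : Fin D → ℤ) : ℂ :=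
  readW N M p m κ x' * srcW N M p m l y' *
    (((if κ = l then 1 else 0) - dAl N p m κ * dbAl N p m l / LAl N p m) / (2 * LAl N p m))

/-- [folklore] `∂♭_m · f̂_m = ∂♭_{ml}·srcW(m,l,y′)` for the unit force source `f̂_m = srcW(m,l,y′)·e_l`. -/
theorem dot_dbAl_fhatF (l : Fin D) (y' : Fin D → ℤ) (m : TorusSite D N) :
    dot (dbAl N p m) (fhatF N M p l y' m) = dbAl N p m l * srcW N M p m l y' := by
  unfold dot fhatF
  rw [Finset.sum_eq_single l (fun κ _ hκ => by rw [if_neg hκ, mul_zero]) (fun h => (h (Finset.mem_univ l)).elim), if_pos rfl]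

/-- [folklore] The capacitance-free response of block `m` to its force source: `Asol(∂_m, ∂♭_m, f̂_m, L_m, 0)_κ = srcW·(δ_{κl} − ∂_{mκ}∂♭_{ml}/L_m)/(2L_m)`. -/
theorem Asol_fhatF_zero (l : Fin D) (y' : Fin D → ℤ) (m : TorusSite D N) (κ : Fin D) :
    Asol (dAl N p m) (dbAl N p m) (fhatF N M p l y' m) (LAl N p m) 0 κ =
      srcW N M p m l y' * (((if κ = l then 1 else 0) - dAl N p m κ * dbAl N p m l / LAl N p m) / (2 * LAl N p m)) := by
  rw [Asol, dot_dbAl_fhatF]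
  unfold fhatF
  split_ifs with h <;> ring

/-- [folklore] `readW · Asol(f̂_m, 0)_κ = tTerm`. -/
theorem readW_mul_Asol_fhatF_zero (l : Fin D) (x' y' : Fin D → ℤ) (m : TorusSite D N) (κ : Fin D) :
    readW N M p m κ x' * Asol (dAl N p m) (dbAl N p m) (fhatF N M p l y' m) (LAl N p m) 0 κ = tTerm N M p m κ l x' y' := by
  rw [Asol_fhatF_zero, tTerm, mul_assoc]

/-- [folklore] `Asol` is ADDITIVE in the pair of feeds `(g, cc)`, componentwise (superposition of sources; = `FibreBlockBounds.Asol_add` applied). -/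
theorem Asol_add_apply (dd db g g' : Fin D → ℂ) (L cc cc' : ℂ) (κ : Fin D) :
    Asol dd db (g + g') L (cc + cc') κ = Asol dd db g L cc κ + Asol dd db g' L cc' κ := by
  simp only [Asol, Pi.add_apply, FibreBlockSolve.dot_add_right]
  ring

/-- [folklore] THE SPLIT of the closed-form amplitude: `Â(m)[force] = Asol(f̂_m, 0) + Asol(FEED_m, χ̂_m c)` with the capacitance feed
`FEED_m = χ̂_m·s♭(m) ⊙ φ` (linearity of `Asol` in `(g, cc)`). -/
theorem Ahat_fhatF_split (l : Fin D) (y' : Fin D → ℤ) (chat : Fin D → ℂ) (m : TorusSite D N) (κ : Fin D) :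
    Ahat N p (fhatF N M p l y') chat m κ =
      Asol (dAl N p m) (dbAl N p m) (fhatF N M p l y' m) (LAl N p m) 0 κ +
        Asol (dAl N p m) (dbAl N p m) (fun l' => chiAl N p m * sbAl N p m l' * phiSol N p (fhatF N M p l y') chat l') (LAl N p m)
          (chiAl N p m * cSol N p (fhatF N M p l y') chat) κ := by
  have hg : gAl N p (fhatF N M p l y') chat m =
      fhatF N M p l y' m + fun l' => chiAl N p m * sbAl N p m l' * phiSol N p (fhatF N M p l y') chat l' := by
    funext l'; rfl
  rw [Ahat, hg, ← Asol_add_apply, zero_add]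

/-- [folklore] **THE ff SUMMAND SPLITS** into the T-summand and the feed summand. -/
theorem ff_summand_split (l : Fin D) (x' y' : Fin D → ℤ) (chat : Fin D → ℂ) (m : TorusSite D N) (κ : Fin D) :
    readW N M p m κ x' * Ahat N p (fhatF N M p l y') chat m κ =
      tTerm N M p m κ l x' y' +
        readW N M p m κ x' * Asol (dAl N p m) (dbAl N p m)
          (fun l' => chiAl N p m * sbAl N p m l' * phiSol N p (fhatF N M p l y') chat l') (LAl N p m)
          (chiAl N p m * cSol N p (fhatF N M p l y') chat) κ := by
  rw [Ahat_fhatF_split, mul_add, readW_mul_Asol_fhatF_zero]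

end Split

/-! ## §2 Real momentum: the label, the reading factor, and the exact factorisation -/

section Real

variable {N : ℕ} [NeZero N]

/-- [folklore] THE SYMMETRIC LABEL of the alias class `m` above the real coarse momentum `pr`: `qlab pr m i = pr_i + 2π·srep m i`. -/
def qlab (pr : Fin D → ℝ) (m : TorusSite D N) : Fin D → ℝ := fun i => pr i + 2 * π * (srep m i : ℝ)

omit [NeZero N] in
/-- [folklore] The symmetrised fine momentum at real `pr` is the real vector `qlab/N`. -/
theorem kSym_ofRealVec (pr : Fin D → ℝ) (m : TorusSite D N) : kSym N (ofRealVec pr) m = ofRealVec (fun i => qlab pr m i / N) := by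
  funext i
  simp only [kSym_apply, ofRealVec, qlab]
  push_cast
  ring

omit [NeZero N] in
/-- [folklore] Coordinate form. -/
theorem kSym_ofRealVec_apply (pr : Fin D → ℝ) (m : TorusSite D N) (i : Fin D) :
    kSym N (ofRealVec pr) m i = ((qlab pr m i / N : ℝ) : ℂ) := by
  rw [kSym_ofRealVec]; rfl

/-- [folklore] `∂_{mκ} = e^{i q_κ/N} − 1` at real momentum. -/
theorem dAl_ofRealVec (pr : Fin D → ℝ) (m : TorusSite D N) (κ : Fin D) :
    dAl N (ofRealVec pr) m κ = cexp (I * ((qlab pr m κ / N : ℝ) : ℂ)) - 1 := by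
  rw [dAl_eq_kSym]
  show cexp (I * kSym N (ofRealVec pr) m κ) - 1 = _
  rw [kSym_ofRealVec_apply]

/-- [folklore] `∂♭_{ml} = e^{−i q_l/N} − 1` at real momentum. -/
theorem dbAl_ofRealVec (pr : Fin D → ℝ) (m : TorusSite D N) (l : Fin D) :
    dbAl N (ofRealVec pr) m l = cexp (-(I * ((qlab pr m l / N : ℝ) : ℂ))) - 1 := by
  rw [dbAl_eq_kSym]
  show cexp (-(I * kSym N (ofRealVec pr) m l)) - 1 = _
  rw [kSym_ofRealVec_apply]

/-- [folklore] THE NORMALISED READING FACTOR `rf N M q = ‖gs(q/N, M)‖/M` (leaf-17's `‖G(q/N, M)‖/M`, `ReadingWeightRatesSum` §2). -/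
def rf (N M : ℕ) (q : ℝ) : ℝ := ‖gs ((q / N : ℝ) : ℂ) M‖ / M

/-- [folklore] `rf ≥ 0`. -/
theorem rf_nonneg (N M : ℕ) (q : ℝ) : 0 ≤ rf N M q := div_nonneg (norm_nonneg _) (Nat.cast_nonneg _)

/-- [folklore] `‖s_{M,i}(m)‖ = M·rf(q_i)` at real momentum (`M ≠ 0`). -/
theorem norm_sMAl_eq (M : ℕ) (hM : M ≠ 0) (pr : Fin D → ℝ) (m : TorusSite D N) (i : Fin D) :
    ‖sMAl N M (ofRealVec pr) m i‖ = M * rf N M (qlab pr m i) := by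
  rw [sMAl_eq_kSym, kSym_ofRealVec_apply, rf]
  have hM' : (M : ℝ) ≠ 0 := Nat.cast_ne_zero.2 hM
  field_simp

/-- [folklore] `‖s♭_{M,i}(m)‖ = M·rf(q_i)` at real momentum. -/
theorem norm_sbMAl_eq (M : ℕ) (hM : M ≠ 0) (pr : Fin D → ℝ) (m : TorusSite D N) (i : Fin D) :
    ‖sbMAl N M (ofRealVec pr) m i‖ = M * rf N M (qlab pr m i) := by
  rw [AliasObjects.sbMAl_eq_conj (AliasObjects.conj_ofRealVec pr), Complex.norm_conj, norm_sMAl_eq M hM]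

/-- [folklore] `s_{M,i}(m)·s♭_{M,i}(m) = (M·rf(q_i))²` (a nonnegative real) at real momentum. -/
theorem sMAl_mul_sbMAl (M : ℕ) (hM : M ≠ 0) (pr : Fin D → ℝ) (m : TorusSite D N) (i : Fin D) :
    sMAl N M (ofRealVec pr) m i * sbMAl N M (ofRealVec pr) m i = (((M * rf N M (qlab pr m i)) ^ 2 : ℝ) : ℂ) := by
  rw [AliasObjects.sbMAl_eq_conj (AliasObjects.conj_ofRealVec pr), Complex.mul_conj, Complex.normSq_eq_norm_sq, norm_sMAl_eq M hM]

/-- [folklore] `S_M(m)·S♭_M(m) = Π_i (M·rf(q_i))²` at real momentum. -/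
theorem SMAl_mul_SbMAl (M : ℕ) (hM : M ≠ 0) (pr : Fin D → ℝ) (m : TorusSite D N) :
    SMAl N M (ofRealVec pr) m * SbMAl N M (ofRealVec pr) m = ((∏ i, (M * rf N M (qlab pr m i)) ^ 2 : ℝ) : ℂ) := by
  unfold SMAl SbMAl
  rw [← Finset.prod_mul_distrib]
  push_cast
  exact Finset.prod_congr rfl fun i _ => by rw [sMAl_mul_sbMAl M hM]; push_cast; ring

/-- [folklore] **`s_{M,κ}(m)·∂_{mκ} = e^{i q_κ/Lc} − 1`** (`N = M·Lc`): the geometric-sum identity `G(z,M)(e^{iz} − 1) = e^{izM} − 1` at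
`z = q_κ/N`, `zM = q_κ/Lc` — LEVEL-FREE. -/
theorem sMAl_mul_dAl {M Lc : ℕ} (hLc : Lc ≠ 0) (hNM : N = M * Lc) (pr : Fin D → ℝ) (m : TorusSite D N) (κ : Fin D) :
    sMAl N M (ofRealVec pr) m κ * dAl N (ofRealVec pr) m κ = cexp (I * ((qlab pr m κ / Lc : ℝ) : ℂ)) - 1 := by
  rw [sMAl_eq_kSym, kSym_ofRealVec_apply, dAl_ofRealVec, gs, AliasWeights.geomExp_mul_sub_one]
  congr 2
  have hLc' : (Lc : ℂ) ≠ 0 := Nat.cast_ne_zero.2 hLc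
  have hNLc : (N : ℂ) = (M : ℂ) * Lc := by rw [hNM]; push_cast; ring
  have hM' : (M : ℂ) ≠ 0 := by
    rintro hM0
    exact (Nat.cast_ne_zero.2 (NeZero.ne N)) (by rw [hNLc, hM0, zero_mul])
  push_cast
  rw [hNLc]
  field_simp

/-- [folklore] **`s♭_{M,l}(m)·∂♭_{ml} = e^{−i q_l/Lc} − 1`** (`N = M·Lc`) — LEVEL-FREE. -/
theorem sbMAl_mul_dbAl {M Lc : ℕ} (hLc : Lc ≠ 0) (hNM : N = M * Lc) (pr : Fin D → ℝ) (m : TorusSite D N) (l : Fin D) :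
    sbMAl N M (ofRealVec pr) m l * dbAl N (ofRealVec pr) m l = cexp (-(I * ((qlab pr m l / Lc : ℝ) : ℂ))) - 1 := by
  rw [sbMAl_eq_kSym, kSym_ofRealVec_apply, dbAl_ofRealVec]
  have e1 : -(I * (((qlab pr m l / N : ℝ) : ℂ))) = I * (-(((qlab pr m l / N : ℝ) : ℂ))) := by ring
  rw [gs, e1, AliasWeights.geomExp_mul_sub_one]
  congr 2
  have hLc' : (Lc : ℂ) ≠ 0 := Nat.cast_ne_zero.2 hLc
  have hNLc : (N : ℂ) = (M : ℂ) * Lc := by rw [hNM]; push_cast; ring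
  have hM' : (M : ℂ) ≠ 0 := by
    rintro hM0
    exact (Nat.cast_ne_zero.2 (NeZero.ne N)) (by rw [hNLc, hM0, zero_mul])
  push_cast
  rw [hNLc]
  field_simp

/-- [folklore] **THE READING PHASES COMBINE to the level-free `e^{i q·(x′−y′)/Lc}`** (`N = M·Lc`; `k·M = q/Lc`, leaf-17's `fine_mul_block_eq`). -/
theorem readPhase_mul_srcPhase {M Lc : ℕ} (hLc : Lc ≠ 0) (hNM : N = M * Lc) (pr : Fin D → ℝ) (m : TorusSite D N) (x' y' : Fin D → ℤ) :
    cexp (I * ∑ i, kAl N (ofRealVec pr) m i * ((M : ℂ) * (x' i : ℂ))) * cexp (-(I * ∑ i, kAl N (ofRealVec pr) m i * ((M : ℂ) * (y' i : ℂ)))) =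
      cexp (I * ∑ i, ((qlab pr m i / Lc : ℝ) : ℂ) * ((x' i : ℂ) - (y' i : ℂ))) := by
  rw [readPhase_eq_kSym, srcPhase_eq_kSym, ← Complex.exp_add]
  congr 1
  have hLc' : (Lc : ℂ) ≠ 0 := Nat.cast_ne_zero.2 hLc
  have hNLc : (N : ℂ) = (M : ℂ) * Lc := by rw [hNM]; push_cast; ring
  have hM' : (M : ℂ) ≠ 0 := by
    rintro hM0
    exact (Nat.cast_ne_zero.2 (NeZero.ne N)) (by rw [hNLc, hM0, zero_mul])
  rw [← mul_neg, ← mul_add, ← Finset.sum_neg_distrib, ← Finset.sum_add_distrib]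
  congr 1
  refine Finset.sum_congr rfl fun i _ => ?_
  have key : kSym N (ofRealVec pr) m i * (M : ℂ) = ((qlab pr m i / Lc : ℝ) : ℂ) := by
    rw [kSym_ofRealVec_apply]; push_cast; rw [hNLc]; field_simp
  rw [← key]
  ring

/-- [folklore] `L_m = ℓ(q)/N²` with `ℓ = latticeSymbol N⁻¹ 0 (qlab)` = `Σ_i N²·4 sin²(q_i/(2N))` (King's currency, `SymbolTaylor` BY NAME). -/
theorem LAl_ofRealVec_eq (pr : Fin D → ℝ) (m : TorusSite D N) :
    LAl N (ofRealVec pr) m = (((latticeSymbol ((N : ℝ)⁻¹) 0 (qlab pr m)) / (N : ℝ) ^ 2 : ℝ) : ℂ) := by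
  have hN : (N : ℝ) ≠ 0 := Nat.cast_ne_zero.2 (NeZero.ne N)
  rw [LAl_eq_kSym, kSym_ofRealVec, SymbolTaylor.lapSym_ofRealVec, ← SymbolTaylor.sum_sq_mul_four_sin_sq_eq_latticeSymbol hN,
    Finset.sum_div]
  congr 1
  refine Finset.sum_congr rfl fun i _ => ?_
  field_simp

/-- [folklore] `readW·srcW` at real momentum: level-free phase × real moduli / `N^D`:
`readW(m,κ,x′)·srcW(m,l,y′) = e^{iq·(x′−y′)/Lc} · (Π_i (M rf_i)²) · s_{M,κ} s♭_{M,l} / (M^{2D+2}·N^D)`. -/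
theorem readW_mul_srcW {M Lc : ℕ} (hLc : Lc ≠ 0) (hM : M ≠ 0) (hNM : N = M * Lc) (pr : Fin D → ℝ) (m : TorusSite D N)
    (κ l : Fin D) (x' y' : Fin D → ℤ) :
    readW N M (ofRealVec pr) m κ x' * srcW N M (ofRealVec pr) m l y' =
      cexp (I * ∑ i, ((qlab pr m i / Lc : ℝ) : ℂ) * ((x' i : ℂ) - (y' i : ℂ))) * ((∏ i, (M * rf N M (qlab pr m i)) ^ 2 : ℝ) : ℂ) *
        (sMAl N M (ofRealVec pr) m κ * sbMAl N M (ofRealVec pr) m l) / ((M : ℂ) ^ (D + 1) * (M : ℂ) ^ (D + 1) * (N : ℂ) ^ D) := by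
  rw [readW, srcW, ← SMAl_mul_SbMAl M hM, ← readPhase_mul_srcPhase hLc hNM pr m x' y']
  ring

/-- [folklore] **THE EXACT FACTORISATION OF THE NORMALISED T-SUMMAND** at real momentum (`N = M·Lc`, `M, Lc ≥ 1`):
`N^D · tTerm = e^{i q·(x′−y′)/Lc} · N² · Π_i rf(q_i)² · ( [κ=l]·rf(q_κ)²/(2ℓ) − Lc²·(e^{iq_κ/Lc} − 1)(e^{−iq_l/Lc} − 1)/(2ℓ²) )`,
`ℓ = latticeSymbol N⁻¹ 0 (qlab)`.  Every factor except the REAL numbers `rf(q_i)` (reading moduli) and `ℓ` (scaled Laplacian symbol) is level-free. -/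
theorem tTerm_factor {M Lc : ℕ} (hLc : Lc ≠ 0) (hM : M ≠ 0) (hNM : N = M * Lc) (pr : Fin D → ℝ) (m : TorusSite D N)
    (κ l : Fin D) (x' y' : Fin D → ℤ) :
    (N : ℂ) ^ D * tTerm N M (ofRealVec pr) m κ l x' y' =
      cexp (I * ∑ i, ((qlab pr m i / Lc : ℝ) : ℂ) * ((x' i : ℂ) - (y' i : ℂ))) * (N : ℂ) ^ 2 *
        (((∏ i, rf N M (qlab pr m i) ^ 2 : ℝ) : ℂ) *
          ((if κ = l then (((rf N M (qlab pr m κ)) ^ 2 : ℝ) : ℂ) else 0) / (2 * ((latticeSymbol ((N : ℝ)⁻¹) 0 (qlab pr m) : ℝ) : ℂ)) -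
            (Lc : ℂ) ^ 2 * (cexp (I * ((qlab pr m κ / Lc : ℝ) : ℂ)) - 1) * (cexp (-(I * ((qlab pr m l / Lc : ℝ) : ℂ))) - 1) /
              (2 * ((latticeSymbol ((N : ℝ)⁻¹) 0 (qlab pr m) : ℝ) : ℂ) ^ 2))) := by
  set ℓ : ℝ := latticeSymbol ((N : ℝ)⁻¹) 0 (qlab pr m) with hℓ
  set Ph : ℂ := cexp (I * ∑ i, ((qlab pr m i / Lc : ℝ) : ℂ) * ((x' i : ℂ) - (y' i : ℂ))) with hPh
  have hM' : (M : ℂ) ≠ 0 := Nat.cast_ne_zero.2 hM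
  have hN' : (N : ℂ) ≠ 0 := Nat.cast_ne_zero.2 (NeZero.ne N)
  have hLc' : (Lc : ℂ) ≠ 0 := Nat.cast_ne_zero.2 hLc
  have hNLc : (N : ℂ) = (M : ℂ) * Lc := by rw [hNM]; push_cast; ring
  have hprod : ((∏ i, (M * rf N M (qlab pr m i)) ^ 2 : ℝ) : ℂ) = (M : ℂ) ^ D * (M : ℂ) ^ D * ((∏ i, rf N M (qlab pr m i) ^ 2 : ℝ) : ℂ) := by
    push_cast
    rw [Finset.prod_congr rfl fun i _ => mul_pow (M : ℂ) _ 2, Finset.prod_mul_distrib, Finset.prod_const, Finset.card_univ,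
      Fintype.card_fin, ← pow_mul]
    ring
  have hL : LAl N (ofRealVec pr) m = (ℓ : ℂ) / (N : ℂ) ^ 2 := by
    rw [LAl_ofRealVec_eq, ← hℓ]; push_cast; ring
  rcases eq_or_ne ℓ 0 with hℓ0 | hℓ0
  · -- degenerate label (`q = 0`): both sides vanish under `x/0 = 0`
    have h0 : tTerm N M (ofRealVec pr) m κ l x' y' = 0 := by
      rw [tTerm, hL, hℓ0]; simp
    rw [h0, hℓ0]; simp
  have hℓ' : (ℓ : ℂ) ≠ 0 := by exact_mod_cast hℓ0
  -- the coefficient with `L_m = ℓ/N²` substituted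
  have hcoef : ((if κ = l then (1 : ℂ) else 0) - dAl N (ofRealVec pr) m κ * dbAl N (ofRealVec pr) m l / LAl N (ofRealVec pr) m) /
      (2 * LAl N (ofRealVec pr) m) =
      (if κ = l then (1 : ℂ) else 0) * (N : ℂ) ^ 2 / (2 * ℓ) -
        dAl N (ofRealVec pr) m κ * dbAl N (ofRealVec pr) m l * (N : ℂ) ^ 4 / (2 * (ℓ : ℂ) ^ 2) := by
    rw [hL]; field_simp
  -- regroup the products: `s s♭` for the δ-term, `(s ∂)(s♭ ∂♭)` for the projector term (pure ring identity)
  have step : (N : ℂ) ^ D * tTerm N M (ofRealVec pr) m κ l x' y' =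
      Ph * ((∏ i, (M * rf N M (qlab pr m i)) ^ 2 : ℝ) : ℂ) / ((M : ℂ) ^ (D + 1) * (M : ℂ) ^ (D + 1)) *
        ((if κ = l then (1 : ℂ) else 0) * (N : ℂ) ^ 2 / (2 * ℓ)) * (sMAl N M (ofRealVec pr) m κ * sbMAl N M (ofRealVec pr) m l) -
      Ph * ((∏ i, (M * rf N M (qlab pr m i)) ^ 2 : ℝ) : ℂ) / ((M : ℂ) ^ (D + 1) * (M : ℂ) ^ (D + 1)) * ((N : ℂ) ^ 4 / (2 * (ℓ : ℂ) ^ 2)) *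
        ((sMAl N M (ofRealVec pr) m κ * dAl N (ofRealVec pr) m κ) * (sbMAl N M (ofRealVec pr) m l * dbAl N (ofRealVec pr) m l)) := by
    rw [tTerm, readW_mul_srcW hLc hM hNM, hcoef, ← hPh]
    field_simp
  rw [step, sMAl_mul_dAl hLc hNM, sbMAl_mul_dbAl hLc hNM, hprod]
  by_cases hκl : κ = l
  · subst hκl
    rw [if_pos rfl, if_pos rfl, sMAl_mul_sbMAl M hM]
    rw [hNLc]
    push_cast
    field_simp
    ring
  · rw [if_neg hκl, if_neg hκl]
    rw [hNLc]
    field_simp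
    ring

end Real

end Summit.QuantumFields.BalabanUV.Beta.GAN24.FibreRateTBlock

end
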